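import Mathlib
import Summits.ValiantsHypothesis.ValiantsHypothesis.Theorems.KPlusLogSqLawWeakLiftingTowerGraftZoneFlux

/-!
# Tower graft line — the EULER-SHIFT ZONE LAW: where `(θ − c)H (u) = Σ_l (e_l − c) u^{e_l} T_l` is positive definite for SOME real
# shift `c`, the weight `u^{−c}` makes `H` strictly Loewner increasing, and the determinant zeros there are paid by the inertia flux

Structure file for LINE (B) `Cruxes/WeakLifting/Lines/tower_graft.lean` (crux `WeakLifting` = stmt-ValiantsHypothesis-19561), closing the series
`…TowerGraftSteepZone` (shift `c = 0`), `…TowerGraftCoEulerZone` (shift `c = D`, the far letter's exponent), `…TowerGraftZoneFlux` (flux form):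

§1 `EulerShiftZone.strictMonoOn_rpow_mul_sum` — the scalar mean-value step: `u ↦ u^{−c} · Σ_l u^{e_l} q_l` is strictly increasing on
   `[a, b] ⊂ (0, ∞)` as soon as `Σ_l (e_l − c) u^{e_l} q_l > 0` there (`(u^{−c} p)' = u^{−c−1}·(θ − c)p`).
§2 `posDef_increments_of_eulerShift` — for the symmetric family `H u = Σ_l u^{e_l}•T_l`: `(θ − c)H ≻ 0` on `[a, b]` ⇒ the normalised family
   `W u = u^{−c} • H u` has positive definite increments on `[a, b]`.
§3 `card_le_of_eulerShift_posDef` (`≤ card ι` zeros of `det H` in `[a, b)`) and `card_add_negInertia_le_of_eulerShift` (flux form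
   `#{zeros in (a, b]} + ν₋(W b) ≤ ν₋(W a)`; `W u = u^{−c}•H u` has the inertia of `H u`) — ONE statement for EVERY real shift `c`:
   `c = 0` is the steep-zone criterion, `c = D` the co-Euler criterion (sign reversed: `(θ − D)H = −(D − θ)G`), and `c = e_{l*}` DELETES the letter
   `l*` from the test (`Σ_{l ≠ l*} (e_l − e_{l*}) u^{e_l} T_l`: letters above `l*` keep their sign, letters below flip it) — `K + 1` distinguished
   class-type tests for a `K + 1`-letter family, plus the continuum between.
§4 `card_roots_Ico_graft_le_of_eulerShift` — graft form for `G + X^D·S` (`S` ANY symmetric far letter): if for some real `c` the shifted pencil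
   `Σ_l (d_l − c) u^{d_l} S_l + (D − c) u^D S` is positive definite on `[a, b]` (`0 < a`), then `det (G + X^D·S)` has at most `m` roots in `[a, b)`.
READING FOR THE LINE (honest): at a root `u*` with kernel vector `v` every shift sees the same number `vᵀ(θ − c)H(u*)v = vᵀθH(u*)v`, so the
shifts do not change WHICH crossings are transversal-up; they change the ZONE TEST away from the kernel, and the union of the Euler-shift zones is
the largest region this «one weight, whole space» method certifies.  The sharp law one level up (only the KERNEL directions at the roots need
`vᵀθHv > 0`) needs continuity of the sorted eigenvalues along the family and is NOT proved here.  Residual zones (no shift definite) = S4/S5 content.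
Zero stub credit; S4/S4b/S5, TowerB, `WeakLifting`, Conjecture B, 18050, VP ≠ VNP untouched.  Def-free; Mathlib + `…TowerGraftZoneFlux` (and through
it `…SteepZone`, `…CoEulerZone`, `…MonotonePencilInertia`).  Seat: prover val-sym-lift-p2 g23, `--supports stmt-ValiantsHypothesis-19561 --as helper`.
[folklore: Rolle / Loewner–Weyl monotonicity; the packaging for the line is this work]
-/

-- `Summit.ValiantsHypothesis.ValiantsHypothesis.…` repeats a component by the D-0017 layout
-- (single-conjunct summit), which the `dupNamespace` linter flags; the name is mandated.
set_option linter.dupNamespace false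
set_option autoImplicit false

namespace Summit.ValiantsHypothesis.ValiantsHypothesis.Theorems.KPlusLogSqLaw.TowerGraft

open Matrix Finset Polynomial
open scoped BigOperators
open Summit.ValiantsHypothesis.ValiantsHypothesis.Theorems.LacunarySymmetroidMatrixDescartes.OneAlternation (dotProduct_family_mulVec)

namespace EulerShiftZone

/-! ## §1 The scalar step: `u^{−c} · p(u)` is strictly increasing where `(θ − c)p > 0` -/

section Scalar

variable {κ : Type} [Fintype κ]

/-- `u · p'(u) = Σ_l e_l u^{e_l} q_l` for `p = Σ_l q_l X^{e_l}`. [folklore] -/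
theorem mul_eval_derivative_sum (e : κ → ℕ) (q : κ → ℝ) (u : ℝ) :
    u * (derivative (∑ l, C (q l) * X ^ e l)).eval u = ∑ l, (e l : ℝ) * u ^ e l * q l := by
  classical
  rw [derivative_sum, eval_finsetSum, Finset.mul_sum]
  refine Finset.sum_congr rfl fun l _ => ?_
  rw [derivative_C_mul, derivative_X_pow, eval_mul, eval_C, eval_mul, eval_C, eval_pow, eval_X]
  rcases Nat.eq_zero_or_pos (e l) with h0 | hpos
  · simp [h0]
  · have : u * u ^ (e l - 1) = u ^ e l := by
      rw [mul_comm]; exact pow_sub_one_mul (Nat.pos_iff_ne_zero.mp hpos) u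
    calc u * (q l * ((e l : ℝ) * u ^ (e l - 1))) = (e l : ℝ) * (u * u ^ (e l - 1)) * q l := by ring
      _ = (e l : ℝ) * u ^ e l * q l := by rw [this]

/-- `p(u) = Σ_l u^{e_l} q_l` for `p = Σ_l q_l X^{e_l}`. [folklore] -/
theorem eval_sum (e : κ → ℕ) (q : κ → ℝ) (u : ℝ) : (∑ l, C (q l) * X ^ e l : ℝ[X]).eval u = ∑ l, u ^ e l * q l := by
  classical
  rw [eval_finsetSum]
  exact Finset.sum_congr rfl fun l _ => by rw [eval_mul, eval_C, eval_pow, eval_X, mul_comm]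

/-- **the scalar Euler-shift step**: if `Σ_l (e_l − c) u^{e_l} q_l > 0` on `[a, b]` (`a > 0`), then `u ↦ u^{−c}·Σ_l u^{e_l} q_l` is strictly
increasing on `[a, b]` (`(u^{−c}p)' = u^{−c−1}(u p' − c p)`; mean value theorem). [folklore] -/
theorem strictMonoOn_rpow_mul_sum (e : κ → ℕ) (q : κ → ℝ) (c : ℝ) {a b : ℝ} (ha : 0 < a)
    (h : ∀ u, a ≤ u → u ≤ b → 0 < ∑ l, ((e l : ℝ) - c) * u ^ e l * q l) :
    StrictMonoOn (fun u : ℝ => u ^ (-c) * ∑ l, u ^ e l * q l) (Set.Icc a b) := by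
  classical
  let p : ℝ[X] := ∑ l, C (q l) * X ^ e l
  have hev : ∀ u, p.eval u = ∑ l, u ^ e l * q l := eval_sum e q
  -- the function and its derivative on `(0, ∞)`
  have hderiv : ∀ u, 0 < u → HasDerivAt (fun u : ℝ => u ^ (-c) * ∑ l, u ^ e l * q l)
      ((-c) * u ^ (-c - 1) * p.eval u + u ^ (-c) * (derivative p).eval u) u := by
    intro u hu
    have h1 : HasDerivAt (fun u : ℝ => u ^ (-c)) ((-c) * u ^ (-c - 1)) u := Real.hasDerivAt_rpow_const (Or.inl hu.ne')
    have h2 : HasDerivAt (fun u : ℝ => p.eval u) ((derivative p).eval u) u := Polynomial.hasDerivAt p u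
    have h3 : HasDerivAt (fun u : ℝ => u ^ (-c) * p.eval u)
        ((-c) * u ^ (-c - 1) * p.eval u + u ^ (-c) * (derivative p).eval u) u := h1.mul h2
    have hfun : (fun u : ℝ => u ^ (-c) * p.eval u) = fun u : ℝ => u ^ (-c) * ∑ l, u ^ e l * q l := by
      funext u; rw [hev]
    rw [hfun] at h3
    exact h3
  -- positivity of the derivative on `[a, b]`
  have hpos : ∀ u, a ≤ u → u ≤ b → 0 < (-c) * u ^ (-c - 1) * p.eval u + u ^ (-c) * (derivative p).eval u := by
    intro u hau hub
    have hu : 0 < u := ha.trans_le hau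
    have hkey : (-c) * u ^ (-c - 1) * p.eval u + u ^ (-c) * (derivative p).eval u =
        u ^ (-c - 1) * (u * (derivative p).eval u - c * p.eval u) := by
      have hsplit : u ^ (-c) = u ^ (-c - 1) * u := by
        rw [show (-c : ℝ) = (-c - 1) + 1 by ring, Real.rpow_add hu, Real.rpow_one, show (-c - 1 + 1 - 1 : ℝ) = -c - 1 by ring]
      rw [hsplit]; ring
    rw [hkey]
    refine mul_pos (Real.rpow_pos_of_pos hu _) ?_
    have hexp : u * (derivative p).eval u - c * p.eval u = ∑ l, ((e l : ℝ) - c) * u ^ e l * q l := by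
      rw [mul_eval_derivative_sum, hev, Finset.mul_sum, ← Finset.sum_sub_distrib]
      exact Finset.sum_congr rfl fun l _ => by ring
    rw [hexp]
    exact h u hau hub
  have hcont : ContinuousOn (fun u : ℝ => u ^ (-c) * ∑ l, u ^ e l * q l) (Set.Icc a b) := fun u hu =>
    (hderiv u (ha.trans_le hu.1)).continuousAt.continuousWithinAt
  refine strictMonoOn_of_deriv_pos (convex_Icc a b) hcont fun x hx => ?_
  rw [interior_Icc] at hx
  rw [(hderiv x (ha.trans hx.1)).deriv]
  exact hpos x hx.1.le hx.2.le

end Scalar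

/-! ## §2 `(θ − c)H ≻ 0` on `[a, b]` ⇒ the normalised family `u^{−c}•H` has positive definite increments -/

section Family

variable {ι : Type} [Fintype ι] [DecidableEq ι] {κ : Type} [Fintype κ]

omit [Fintype ι] [DecidableEq ι] in
/-- the normalised family `u^{−c} • Σ_l u^{e_l}•T_l` is Hermitian for symmetric letters. [folklore] -/
theorem isHermitian_shift (e : κ → ℕ) (Tm : κ → Matrix ι ι ℝ) (hTm : ∀ l, (Tm l).IsSymm) (c u : ℝ) :
    ((u ^ (-c)) • ∑ l, (u ^ e l) • Tm l).IsHermitian := by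
  unfold Matrix.IsHermitian
  rw [Matrix.conjTranspose_smul, star_trivial, (SteepZone.isHermitian_family (fun l => u ^ e l) Tm hTm).eq]

omit [DecidableEq ι] in
/-- **`(θ − c)H ≻ 0` ⇒ positive definite increments of `u^{−c}•H` on `[a, b]`** (`a > 0`): for `H u = Σ_l u^{e_l}•T_l` with symmetric
letters and a real shift `c`, if `Σ_l ((e_l − c) u^{e_l})•T_l ≻ 0` for all `u ∈ [a, b]`, then `t^{−c}•H t − s^{−c}•H s ≻ 0` for
`a ≤ s < t ≤ b`. [this work] -/
theorem posDef_increments_of_eulerShift (e : κ → ℕ) (Tm : κ → Matrix ι ι ℝ) (hTm : ∀ l, (Tm l).IsSymm) (c : ℝ) {a b : ℝ}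
    (ha : 0 < a) (hθ : ∀ u, a ≤ u → u ≤ b → (∑ l, (((e l : ℝ) - c) * u ^ e l) • Tm l).PosDef) :
    ∀ s t : ℝ, a ≤ s → s < t → t ≤ b →
      (((t ^ (-c)) • ∑ l, (t ^ e l) • Tm l) - ((s ^ (-c)) • ∑ l, (s ^ e l) • Tm l)).PosDef := by
  intro s t hs hst htb
  refine Matrix.PosDef.of_dotProduct_mulVec_pos ((isHermitian_shift e Tm hTm c t).sub (isHermitian_shift e Tm hTm c s))
    fun x hx => ?_
  rw [star_trivial, Matrix.sub_mulVec, dotProduct_sub, Matrix.smul_mulVec, Matrix.smul_mulVec, dotProduct_smul, dotProduct_smul,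
    smul_eq_mul, smul_eq_mul, dotProduct_family_mulVec, dotProduct_family_mulVec]
  have hq : ∀ u, a ≤ u → u ≤ b → 0 < ∑ l, ((e l : ℝ) - c) * u ^ e l * (x ⬝ᵥ (Tm l *ᵥ x)) := by
    intro u hau hub
    have h1 := (hθ u hau hub).dotProduct_mulVec_pos hx
    rwa [star_trivial, dotProduct_family_mulVec] at h1
  have hsm := strictMonoOn_rpow_mul_sum e (fun l => x ⬝ᵥ (Tm l *ᵥ x)) c ha hq
  exact sub_pos.mpr (hsm ⟨hs, hst.le.trans htb⟩ ⟨hs.trans hst.le, htb⟩ hst)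

/-- the normalised family is singular exactly where `H` is (`u > 0`). [folklore] -/
theorem det_shift_eq_zero_iff (e : κ → ℕ) (Tm : κ → Matrix ι ι ℝ) (c : ℝ) {u : ℝ} (hu : 0 < u) :
    ((u ^ (-c)) • ∑ l, (u ^ e l) • Tm l).det = 0 ↔ (∑ l, (u ^ e l) • Tm l).det = 0 := by
  rw [Matrix.det_smul, mul_eq_zero, or_iff_right (pow_ne_zero _ (Real.rpow_pos_of_pos hu _).ne')]

/-! ## §3 The Euler-shift zone laws -/

/-- **EULER-SHIFT ZONE LAW (`≤ card ι`).**  `H u = Σ_l u^{e_l}•T_l` with symmetric letters, `0 < a`; if for SOME real shift `c` the shifted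
family `Σ_l ((e_l − c) u^{e_l})•T_l` is positive definite for every `u ∈ [a, b]`, then `det H` has at most `card ι` zeros in `[a, b)`.
(`c = 0`: steep-zone criterion; `c` = top exponent: co-Euler criterion; `c = e_{l*}`: letter `l*` deleted from the test.) [this work] -/
theorem card_le_of_eulerShift_posDef (e : κ → ℕ) (Tm : κ → Matrix ι ι ℝ) (hTm : ∀ l, (Tm l).IsSymm) (c : ℝ) {a b : ℝ} (ha : 0 < a)
    (hθ : ∀ u, a ≤ u → u ≤ b → (∑ l, (((e l : ℝ) - c) * u ^ e l) • Tm l).PosDef)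
    (T : Finset ℝ) (hT : ∀ t ∈ T, a ≤ t ∧ t < b ∧ (∑ l, (t ^ e l) • Tm l).det = 0) : T.card ≤ Fintype.card ι :=
  SteepZone.card_le_of_posDef_increments (fun u => (u ^ (-c)) • ∑ l, (u ^ e l) • Tm l)
    (fun u => by simpa using (isHermitian_shift e Tm hTm c u)) ha (posDef_increments_of_eulerShift e Tm hTm c ha hθ) T
    fun t ht => ⟨(hT t ht).1, (hT t ht).2.1, (det_shift_eq_zero_iff e Tm c (ha.trans_le (hT t ht).1)).mpr (hT t ht).2.2⟩

/-- **EULER-SHIFT ZONE LAW, FLUX FORM.**  Same hypotheses with `a ≤ b`: `#{zeros of det H in (a, b]} + ν₋(W b) ≤ ν₋(W a)` for the normalised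
family `W u = u^{−c}•H u` (a positive multiple of `H u`, so `ν₋(W u)` is the negative inertia of `H u`; `ν₋` written inline on Mathlib's sorted
eigenvalues). [this work] -/
theorem card_add_negInertia_le_of_eulerShift (e : κ → ℕ) (Tm : κ → Matrix ι ι ℝ) (hTm : ∀ l, (Tm l).IsSymm) (c : ℝ) {a b : ℝ}
    (ha : 0 < a) (hab : a ≤ b) (hθ : ∀ u, a ≤ u → u ≤ b → (∑ l, (((e l : ℝ) - c) * u ^ e l) • Tm l).PosDef)
    (T : Finset ℝ) (hT : ∀ t ∈ T, a < t ∧ t ≤ b ∧ (∑ l, (t ^ e l) • Tm l).det = 0) :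
    T.card + (univ.filter fun k => (isHermitian_shift e Tm hTm c b).eigenvalues₀ k < 0).card ≤
      (univ.filter fun k => (isHermitian_shift e Tm hTm c a).eigenvalues₀ k < 0).card :=
  ZoneFlux.card_add_negInertia_le (fun u => (u ^ (-c)) • ∑ l, (u ^ e l) • Tm l) (fun u => isHermitian_shift e Tm hTm c u) hab
    (posDef_increments_of_eulerShift e Tm hTm c ha hθ) T
    fun t ht => ⟨(hT t ht).1, (hT t ht).2.1, (det_shift_eq_zero_iff e Tm c (ha.trans (hT t ht).1)).mpr (hT t ht).2.2⟩

end Family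

/-! ## §4 Graft form: `G + X^D·S` with ANY symmetric far letter -/

section Graft

variable {m K : ℕ}

/-- **EULER-SHIFT ZONE LAW FOR A ONE-LETTER GRAFT.**  `G = Σ_l X^{d_l} S_l` (symmetric `m × m` letters), `S` ANY symmetric far letter at exponent
`D`, `0 < a`; if for SOME real shift `c` the shifted pencil `Σ_l ((d_l − c) u^{d_l})•S_l + ((D − c) u^D)•S` is positive definite for every
`u ∈ [a, b]`, then `det (G + X^D·S)` has at most `m` roots in `[a, b)`.  (`c = D` is `…CoEulerZone` up to the endpoint convention, `c = 0` with a
definite dominant `S` is `…SteepZone`'s criterion, `c = d_{l*}` deletes the base letter `l*` from the test.) [this work] -/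
theorem card_roots_Ico_graft_le_of_eulerShift (D : ℕ) (d : Fin K → ℕ) (S : Fin K → Matrix (Fin m) (Fin m) ℝ)
    (hS : ∀ l, (S l).IsSymm) (Sfar : Matrix (Fin m) (Fin m) ℝ) (hSfar : Sfar.IsSymm) (c : ℝ) {a b : ℝ} (ha : 0 < a)
    (hθ : ∀ u, a ≤ u → u ≤ b →
      ((∑ l, (((d l : ℝ) - c) * u ^ d l) • S l) + (((D : ℝ) - c) * u ^ D) • Sfar).PosDef) :
    ((Matrix.det ((∑ l, ((X : ℝ[X]) ^ d l) • (S l).map C) + ((X : ℝ[X]) ^ D) • Sfar.map C)).roots.toFinset.filter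
      (fun t => a ≤ t ∧ t < b)).card ≤ m := by
  classical
  set f := Matrix.det ((∑ l, ((X : ℝ[X]) ^ d l) • (S l).map C) + ((X : ℝ[X]) ^ D) • Sfar.map C) with hf
  let e : Fin (K + 1) → ℕ := Fin.snoc d D
  let Tm : Fin (K + 1) → Matrix (Fin m) (Fin m) ℝ := Fin.snoc S Sfar
  have hTm : ∀ l, (Tm l).IsSymm := by
    intro l
    induction l using Fin.lastCases with
    | last => simpa [Tm] using hSfar
    | cast l => simpa [Tm] using hS l
  have hθ' : ∀ u, a ≤ u → u ≤ b → (∑ l, (((e l : ℝ) - c) * u ^ e l) • Tm l).PosDef := by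
    intro u hau hub
    have hfam : (∑ l, (((e l : ℝ) - c) * u ^ e l) • Tm l) =
        (∑ l, (((d l : ℝ) - c) * u ^ d l) • S l) + (((D : ℝ) - c) * u ^ D) • Sfar := by
      show (∑ l : Fin (K + 1), (((((Fin.snoc d D : Fin (K + 1) → ℕ) l : ℕ) : ℝ) - c) *
          u ^ (Fin.snoc d D : Fin (K + 1) → ℕ) l) • (Fin.snoc S Sfar : Fin (K + 1) → _) l) = _
      rw [Fin.sum_univ_castSucc]
      simp only [Fin.snoc_castSucc, Fin.snoc_last]
    rw [hfam]
    exact hθ u hau hub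
  have hmain := card_le_of_eulerShift_posDef e Tm hTm c ha hθ' (f.roots.toFinset.filter fun t => a ≤ t ∧ t < b) fun t ht => by
    rw [Finset.mem_filter, Multiset.mem_toFinset] at ht
    refine ⟨ht.2.1, ht.2.2, ?_⟩
    have hr := (Polynomial.mem_roots'.mp ht.1).2
    rw [Polynomial.IsRoot.def, hf, SteepZone.eval_det_graft] at hr
    exact hr
  simpa using hmain

end Graft

end EulerShiftZone

end Summit.ValiantsHypothesis.ValiantsHypothesis.Theorems.KPlusLogSqLaw.TowerGraft
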